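import Summits.QuantumFields.YangMills.Theorems.ColdStartUniversalityLatticeLangevinMixingTimeExplicit
import Summits.QuantumFields.YangMills.Theorems.ColdStartUniversalityUniformColdStartMixingFixedCutoffLogSobolevWindow
import HarnessLib

/-!
# Route `ColdStartUniversality`, aside K_A1 `UniformColdStartMixing` (24809) — the FIXED-CUT-OFF COLD-START MIXING TIME IN THE STRONG-COUPLING
# WINDOW, EXPLICITLY: at cut-offs `K` with `γ ε_K > 6`, every bounded observable of the SZZ dynamics is within `ε` of its `μ_K`-mean after
# `2 + log(√(2B_K)/ε)/(1 − 6/(γε_K))` lattice time units, from EVERY start — `B_K = O(L_K³)`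

Helper file (seat `ym-line-csu-p1`, g27; `--supports stmt-QuantumFields-24809`).  Planner-facing reading of `…MixingTimeExplicit` in the route's
cut-off vocabulary (`β'_K = (γε_K)⁻¹/2`, lattice `L_K = (F.P K).sitesPerDir 0`, cf. g26's `uniformLogSobolev_fixedCutoff_window`):
* ★★ `coldStart_observable_fixedCutoff_window_explicit` — at a cut-off `K` with `6 < γ ε_K`: for every solution of the SZZ dynamics at `β'_K`
  from any deterministic start, every measurable `|g| ≤ 1` and every lattice time `u ≥ 0`,
  `|E g(U_(2+u)) − ∫ g dμ_K| ≤ e^(−(1 − 6/(γε_K))·u) · √(2B_K)`, `B_K = 366·β'_K·L_K³ + 3log(3/2)·L_K³ + log 2`;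
* ★★ `coldStart_mixingTime_fixedCutoff_window_explicit` — for `ε > 0` and `u ≥ log(√(2B_K)/ε)/(1 − 6/(γε_K))`: `|E g(U_(2+u)) − ∫ g dμ_K| ≤ ε`.
So INSIDE the window the fixed-cut-off input (M) of the rung `stub_fixedCutoffMixing` holds with a mixing time `O(log L_K + log(1/ε))` lattice units
(= `O(ε_K(log L_K + log(1/ε)))` in the crux's physical time `s = ε_K t`), uniformly in the start.
PLANNER-FACING, HONEST: the window `γ ε_K > 6` contains only the COARSE cut-offs; for `K → ∞` (`ε_K → 0`, `β'_K → ∞`) the only explicit rate in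
the tree is Holley–Stroock's `e^(−4β'_K·#𝒫_K)` (`wilson_coldStart_mixingTime_allCoupling_explicit`, useless uniformly in `K`).  Nothing K-uniform is
proved; 24809 is ASIDE and NOT restated; no crux, rung of the ladder or summit statement is proved; the Yang–Mills mass gap is NOT proved.
-/

set_option autoImplicit false

noncomputable section

namespace Summit.QuantumFields.YangMills.Theorems.ColdStartUniversality

open MeasureTheory ProbabilityTheory
open scoped NNReal ENNReal BigOperators
open Literature.Probability.Process Literature.MathematicalPhysics.QuantumFieldTheory
open Literature.MathematicalPhysics.QuantumLattice (fundamentalRep fundamentalLatticeRep continuous_fundamentalRep)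
open Literature.MathematicalPhysics.QuantumFieldTheory.Balaban1983to89

/-- In the window `6 < γ ε_K` the coupling `β'_K = (γε_K)⁻¹/2` satisfies `|β'_K| < 1/12` and `1 − 12|β'_K| = 1 − 6/(γε_K)`. [folklore] -/
theorem window_coupling_bounds (F : T3ContinuumYM3Torus.T3Family) (γ : ℝ) (K : ℕ) (hK : 6 < γ * (F.P K).eps) :
    |((γ * (F.P K).eps)⁻¹ / 2)| < 1 / 12 ∧ 1 - 12 * |((γ * (F.P K).eps)⁻¹ / 2)| = 1 - 6 / (γ * (F.P K).eps) := by
  have hγε : 0 < γ * (F.P K).eps := lt_trans (by norm_num) hK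
  refine ⟨?_, ?_⟩
  · rw [abs_of_pos (by positivity)]
    rw [div_lt_iff₀ (by norm_num : (0:ℝ) < 2), inv_lt_comm₀ hγε (by norm_num)]
    linarith
  · rw [abs_of_pos (by positivity)]
    field_simp
    ring

/-- ★★ **Explicit cold-start mixing of bounded observables at a cut-off in the strong-coupling window.**  For `6 < γ ε_K`, every solution of the
SZZ dynamics at `β'_K = (γε_K)⁻¹/2` on `(ℤ/L_K)³` from a deterministic start, every measurable `|g| ≤ 1`, every lattice time `u ≥ 0`:
`|E g(U_(2+u)) − ∫ g dμ_K| ≤ e^(−(1 − 6/(γε_K)) u) √(2B_K)`. [cite: ShenZhuZhu2022, §4 Theorem 4.2] -/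
theorem coldStart_observable_fixedCutoff_window_explicit (F : T3ContinuumYM3Torus.T3Family) (γ : ℝ) (K : ℕ) (hK : 6 < γ * (F.P K).eps)
    (z : (GaugeConfig 3 ((F.P K).sitesPerDir 0) (Matrix.specialUnitaryGroup (Fin 2) ℂ)))
    {Ω : Type} [MeasurableSpace Ω] {P : Measure Ω} [IsProbabilityMeasure P]
    {W : ℝ≥0 → Ω → (Edge 3 ((F.P K).sitesPerDir 0) × NoiseIdx 2 → ℝ)} (hW : IsFlatBrownian W P)
    {U : ℝ≥0 → Ω → (GaugeConfig 3 ((F.P K).sitesPerDir 0) (Matrix.specialUnitaryGroup (Fin 2) ℂ))} (hU0 : ∀ ω, U 0 ω = z)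
    (hU : (latticeLangevinDynamics (fundamentalLatticeRep 2) ((γ * (F.P K).eps)⁻¹ / 2)).IsSolution (fundamentalRep (Fin 2)) hW.natFiltration P W U)
    (u : ℝ≥0) {g : (GaugeConfig 3 ((F.P K).sitesPerDir 0) (Matrix.specialUnitaryGroup (Fin 2) ℂ)) → ℝ} (hgm : Measurable g) (hgb : ∀ x, |g x| ≤ 1) :
    |(∫ ω, g (U ((2 : ℝ≥0) + u) ω) ∂P) - ∫ x, g x ∂(wilsonMeasure (d := 3) (L := ((F.P K).sitesPerDir 0)) (fundamentalRep (Fin 2)) ((γ * (F.P K).eps)⁻¹ / 2))| ≤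
      Real.exp (-(1 - 6 / (γ * (F.P K).eps)) * u) * Real.sqrt (2 * (366 * |((γ * (F.P K).eps)⁻¹ / 2)| * (((F.P K).sitesPerDir 0) : ℝ) ^ 3 + 3 * Real.log (3 / 2) * (((F.P K).sitesPerDir 0) : ℝ) ^ 3 + Real.log 2)) := by
  obtain ⟨hβ, hrate⟩ := window_coupling_bounds F γ K hK
  have h := wilson_coldStart_observable_le_exp_explicit ((F.P K).sitesPerDir 0) ((γ * (F.P K).eps)⁻¹ / 2) hβ z hW hU0 hU u hgm hgb
  rw [hrate] at h
  exact h

/-- ★★ **Explicit mixing time at a cut-off in the window**: for `ε > 0` and `u ≥ log(√(2B_K)/ε)/(1 − 6/(γε_K))`, `|E g(U_(2+u)) − ∫ g dμ_K| ≤ ε`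
for all measurable `|g| ≤ 1`, all starts, all solutions — the input (M) of `stub_fixedCutoffMixing` with mixing time `O(log L_K + log(1/ε))` inside
the window. [cite: ShenZhuZhu2022, §4 Theorem 4.2, Corollary 4.4] -/
theorem coldStart_mixingTime_fixedCutoff_window_explicit (F : T3ContinuumYM3Torus.T3Family) (γ : ℝ) (K : ℕ) (hK : 6 < γ * (F.P K).eps)
    (z : (GaugeConfig 3 ((F.P K).sitesPerDir 0) (Matrix.specialUnitaryGroup (Fin 2) ℂ)))
    {Ω : Type} [MeasurableSpace Ω] {P : Measure Ω} [IsProbabilityMeasure P]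
    {W : ℝ≥0 → Ω → (Edge 3 ((F.P K).sitesPerDir 0) × NoiseIdx 2 → ℝ)} (hW : IsFlatBrownian W P)
    {U : ℝ≥0 → Ω → (GaugeConfig 3 ((F.P K).sitesPerDir 0) (Matrix.specialUnitaryGroup (Fin 2) ℂ))} (hU0 : ∀ ω, U 0 ω = z)
    (hU : (latticeLangevinDynamics (fundamentalLatticeRep 2) ((γ * (F.P K).eps)⁻¹ / 2)).IsSolution (fundamentalRep (Fin 2)) hW.natFiltration P W U)
    {ε : ℝ} (hε : 0 < ε) (u : ℝ≥0)
    (hu : Real.log (Real.sqrt (2 * (366 * |((γ * (F.P K).eps)⁻¹ / 2)| * (((F.P K).sitesPerDir 0) : ℝ) ^ 3 + 3 * Real.log (3 / 2) * (((F.P K).sitesPerDir 0) : ℝ) ^ 3 + Real.log 2)) / ε) / (1 - 6 / (γ * (F.P K).eps)) ≤ (u : ℝ))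
    {g : (GaugeConfig 3 ((F.P K).sitesPerDir 0) (Matrix.specialUnitaryGroup (Fin 2) ℂ)) → ℝ} (hgm : Measurable g) (hgb : ∀ x, |g x| ≤ 1) :
    |(∫ ω, g (U ((2 : ℝ≥0) + u) ω) ∂P) - ∫ x, g x ∂(wilsonMeasure (d := 3) (L := ((F.P K).sitesPerDir 0)) (fundamentalRep (Fin 2)) ((γ * (F.P K).eps)⁻¹ / 2))| ≤ ε := by
  obtain ⟨hβ, hrate⟩ := window_coupling_bounds F γ K hK
  rw [← hrate] at hu
  exact wilson_coldStart_mixingTime_log_volume ((F.P K).sitesPerDir 0) ((γ * (F.P K).eps)⁻¹ / 2) hβ z hW hU0 hU hε u hu hgm hgb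

end Summit.QuantumFields.YangMills.Theorems.ColdStartUniversality
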